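import Summits.SmoothPoincare4.SmoothPoincare4.Theorems.SblfDescentRungOneStubSliceRecognitionAux3
import Summits.SmoothPoincare4.SmoothPoincare4.Theorems.SblfDescentRungOneStubSliceRecognitionAux4
import Summits.SmoothPoincare4.SmoothPoincare4.Theorems.SblfDescentRungOneStubSliceRecognitionAux5
import HarnessLib

/-!
# Four-sphere recognition from a slice-preserving genus-one gluing — stub `stub_sliceRecognition`
# of line `Sketch`, crux `SblfDescent.RungOne`

(Crux item stmt-SmoothPoincare4-18531; skeleton `Cruxes/RungOne/Lines/Sketch.lean`.)

**Statement.** Let `S = {Σ xᵢ² = 1} ⊆ ℝ⁵` be the level sphere with its genus-one splitting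
`S = W₀ ∪ V₀`, `W₀ = {x₃² + x₄² ≤ 1/2} ≅ S² × D²`, `V₀ = {x₃² + x₄² ≥ 1/2} ≅ S¹ × B³`
(`SphereFourSplitting`, `SphereFourGenusOneSplitting.lean`).  If a closed smooth 4-manifold `X`
is a gluing `W₀ ∪_φ V₀` along a diffeomorphism `φ : ∂W₀ ≅ ∂V₀` which PRESERVES THE SLICES
`x₃, x₄` (so that `φ(y, w) = (g_w y, w)` on `∂W₀ = S²(1/√2) × S¹(1/√2)`, a circle's worth of
diffeomorphisms of `S²`), then `X ≅ 𝕊⁴`.  This is the Laudenbach–Poénaru-free form of the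
endgame of the genus-one simplified broken Lefschetz fibration argument (Auroux–Donaldson–
Katzarkov 2005, §8.2, Ex. 1; Baykur–Kamada 2015, §5): for slice-preserving `φ` no extension
theorem for diffeomorphisms of `S¹ × S²` is needed, only `π₀` and `π₁` of `Diff(S²)` (Smale
1959; Cerf 1968, Appendice §5, Cor. 2: `π_i O(3) ≅ π_i Diff(S²)`), both PROVED in the tree.

**Proof.** (1) `φ` is the suspension of a smooth circle-family `g : 𝕊¹ × S² → S²` of
diffeomorphisms with smooth fibrewise inverse (`helper_sliceRec_family`).  (2) Three jointly
smooth paths of such families (part IV): (a) collapsing the parameter near the base point,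
`g ↝ u ↦ g (circlePt (β (angA u)))`; (b) Cerf's deformation of the based loop
`g (circlePt (β ·)) ∘ (g ptA)⁻¹` to its frame loop of rotations `A`,
`↝ u ↦ A(angA u) ∘ g ptA`; (c) Smale's theorem at `π₀`, `g ptA ↝ L|S²`, `L ∈ {1, reflection}`,
`↝ u ↦ A(angA u) ∘ L|S²`.  Each path suspends to a smooth isotopy of diffeomorphisms
`∂W₀ ≅ ∂V₀` (`helper_sliceRec_isotopy`), so `φ` is smoothly isotopic to the suspension `χ` of the
circle of isometries `u ↦ A(angA u) ∘ L|S²`.  (3) That circle of isometries extends linearly over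
`V₀ ≅ B³ × S¹`, so `S = W₀ ∪_{id} V₀` is also `W₀ ∪_χ V₀` (`helper_sliceRec_reglue`, Hirsch 1976,
Ch. 8 §2, Thm. 2.2).  (4) Gluings along isotopic diffeomorphisms are diffeomorphic (Hirsch 1976,
Ch. 8 §2, Thm. 2.3: `IsBoundaryGluing.of_isSmoothlyIsotopic`,
`nonempty_diffeomorph_of_isBoundaryGluing_holds`), so `X ≅ S ≅ 𝕊⁴` (`sphereLevelDiffeomorph`).

## References

* D. Auroux, S. K. Donaldson, L. Katzarkov, *Singular Lefschetz pencils*, Geom. Topol. 9 (2005),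
  §8.2, Example 1. [AurouxDonaldsonKatzarkov2005]
* R. İ. Baykur, S. Kamada, *Classification of broken Lefschetz fibrations with small fiber
  genera*, J. Math. Soc. Japan 67 (2015), §5. [BaykurKamada2015]
* J. Cerf, *Sur les difféomorphismes de la sphère de dimension trois (Γ₄ = 0)*, LNM 53 (1968),
  Appendice §5, Corollaire 2. [CerfDiffeoSphere1968]
* S. Smale, *Diffeomorphisms of the 2-sphere*, Proc. AMS 10 (1959) 621–626.
* H. Gluck, *The embedding of two-spheres in the four-sphere*, Trans. AMS 104 (1962), §5.
* M. W. Hirsch, *Differential Topology*, GTM 33 (1976), Ch. 8 §2, Thms. 2.2–2.3. [HirschDT1976]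
-/

set_option linter.dupNamespace false

noncomputable section

open scoped Manifold ContDiff Topology RealInnerProductSpace
open Set Function Literature.Topology.FourManifolds Literature.AlgebraicTopology.SingularHomology

namespace Summit.SmoothPoincare4.SmoothPoincare4.Cruxes.RungOne.Sketch

/-- Local notation: `𝔼 n` is the model Euclidean space `EuclideanSpace ℝ (Fin n)`. -/
local notation "𝔼 " n:arg => EuclideanSpace ℝ (Fin n)

/-- Local notation: `𝕊²`, the unit sphere of `ℝ³`. -/
local notation "𝕊²" => (Metric.sphere (0 : EuclideanSpace ℝ (Fin 3)) (1 : ℝ))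

attribute [local instance] Literature.Topology.FourManifolds.fact_finrank_euclideanSpace_succ

/-- **Stub `stub_sliceRecognition`: four-sphere recognition from a slice-preserving genus-one
gluing.**  If `X` is a gluing `W₀ ∪_φ V₀` of the two tubes of the genus-one splitting of the level
sphere `S ⊆ ℝ⁵` along a diffeomorphism `φ : ∂W₀ ≅ ∂V₀` preserving the coordinates `x₃, x₄`, then
`X ≅ 𝕊⁴`: `φ` is the suspension of a circle of diffeomorphisms of `S²`, smoothly isotopic (Smale
1959 at `π₀`, Cerf 1968 at `π₁` of `Diff(S²)`) to the suspension of a circle of isometries, which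
extends over `V₀`; gluings along isotopic diffeomorphisms are diffeomorphic (Hirsch 1976, Ch. 8
§2), so `X ≅ W₀ ∪_{id} V₀ = S ≅ 𝕊⁴`. [cite: CerfDiffeoSphere1968, Appendice §5, Corollaire 2]
[cite: HirschDT1976, Ch. 8 §2, Thm. 2.3] [cite: AurouxDonaldsonKatzarkov2005, §8.2 Example 1] -/
theorem stub_sliceRecognition :
    ∀ (φ : (𝓡∂ 4).boundary SphereFourSplitting.EquatorTube ≃ₘ⟮𝓡 3, 𝓡 3⟯
        (𝓡∂ 4).boundary SphereFourSplitting.PolarTube),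
      (∀ z, SphereFourSplitting.ι (SphereFourSplitting.ιV (φ z).1) 3 =
          SphereFourSplitting.ι (RegularSublevel.incl SphereFourSplitting.isRegularLevel_tubeS z.1) 3 ∧
        SphereFourSplitting.ι (SphereFourSplitting.ιV (φ z).1) 4 =
          SphereFourSplitting.ι (RegularSublevel.incl SphereFourSplitting.isRegularLevel_tubeS z.1) 4) →
      ∀ (X : Type) [TopologicalSpace X] [ChartedSpace (𝔼 4) X] [IsManifold (𝓡 4) ∞ X],
        IsBoundaryGluing (RegularSublevel.boundaryData SphereFourSplitting.isRegularLevel_tubeS)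
          (RegularSublevel.boundaryData SphereFourSplitting.hPolar) φ (𝓡 4) X →
        Nonempty (X ≃ₘ⟮𝓡 4, 𝓡 4⟯ (Metric.sphere (0 : 𝔼 5) 1)) := by
  intro φ hφ X _ _ _ hX
  -- (1) the circle-family of `φ`
  obtain ⟨g, gi, hg, hgi, hgig, hggi, hφcorr⟩ := helper_sliceRec_family φ hφ
  -- (2a) collapsing near the base point
  obtain ⟨Ha, Hai, hHa, hHai, h1a, h2a, hHa0, hHa1⟩ := exists_path_collapse g gi hg hgi hgig hggi
  -- (2b) Cerf: the based loop deforms to its frame loop of rotations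
  obtain ⟨A, Hb, Hbi, hA, hAflat, hHb, hHbi, h1b, h2b, hHb0, hHb1⟩ :=
    helper_sliceRec_cerf g gi hg hgi hgig hggi
  -- (2c) Smale: the base diffeomorphism deforms to an isometry
  have hg0 : ContMDiff (𝓡 2) (𝓡 2) ∞ (g ptA) := hg.comp (contMDiff_const.prodMk contMDiff_id)
  have hgi0 : ContMDiff (𝓡 2) (𝓡 2) ∞ (gi ptA) := hgi.comp (contMDiff_const.prodMk contMDiff_id)
  obtain ⟨L, Hc, Hci, hHc, hHci, h1c, h2c, hHc0, hHc1⟩ :=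
    exists_path_smale (g ptA) (gi ptA) hg0 hgi0 (fun x => hgig _ _) (fun x => hggi _ _) A hA hAflat
  -- the three isotopies
  obtain ⟨χa, hχa, iso1⟩ := helper_sliceRec_isotopy Ha Hai hHa hHai h1a h2a φ fun z =>
    ⟨(hφcorr z).1, fun u hu => by rw [hHa0]; exact (hφcorr z).2 u hu⟩
  obtain ⟨χb, hχb, iso2⟩ := helper_sliceRec_isotopy Hb Hbi hHb hHbi h1b h2b χa fun z =>
    ⟨(hχa z).1, fun u hu => by rw [hHb0, ← hHa1]; exact (hχa z).2 u hu⟩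
  obtain ⟨χc, hχc, iso3⟩ := helper_sliceRec_isotopy Hc Hci hHc hHci h1c h2c χb fun z =>
    ⟨(hχb z).1, fun u hu => by rw [hHc0, ← hHb1]; exact (hχb z).2 u hu⟩
  have hiso : IsSmoothlyIsotopic (𝓡 3) (𝓡 3) φ χc :=
    IsSmoothlyIsotopic.trans_holds iso1 (IsSmoothlyIsotopic.trans_holds iso2 iso3)
  -- (3) the circle of isometries extends over the polar tube: re-gluing the level sphere
  have hS : IsBoundaryGluing (RegularSublevel.boundaryData SphereFourSplitting.isRegularLevel_tubeS)
      (RegularSublevel.boundaryData SphereFourSplitting.hPolar) χc (𝓡 4) SphereFourSplitting.LevelSphere :=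
    helper_sliceRec_reglue A hA hAflat L χc fun z =>
      ⟨(hχc z).1, fun u hu => by rw [← hHc1]; exact (hχc z).2 u hu⟩
  -- (4) gluings along isotopic diffeomorphisms are diffeomorphic
  have hS' : IsBoundaryGluing (RegularSublevel.boundaryData SphereFourSplitting.isRegularLevel_tubeS)
      (RegularSublevel.boundaryData SphereFourSplitting.hPolar) φ (𝓡 4) SphereFourSplitting.LevelSphere :=
    hS.of_isSmoothlyIsotopic hiso
  obtain ⟨e⟩ := nonempty_diffeomorph_of_isBoundaryGluing_holds hX hS'
  exact ⟨e.trans SphereFourSplitting.sphereLevelDiffeomorph⟩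

end Summit.SmoothPoincare4.SmoothPoincare4.Cruxes.RungOne.Sketch

end
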